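import Summits.BirchSwinnertonDyer.BirchSwinnertonDyer.Theorems.PrintCf2RubinValueTwoFrameSeed
import HarnessLib

/-!
# B18s AT `j = 0` — the seed supply with its infinity type `(−a, 0)` EXPOSED (piece S1 of the `j = 0` two-variable
# Katz period rigidity, LEAD memo `Cruxes/KatzDistributionsAtTwoPrint/LEAD-MEMO-JZERO-RIGIDITY-g18.md`)

Cell `bsd-print-cf2`, LEAD seat `bsd-line-cf2-p1` g18; `--supports stmt-BirchSwinnertonDyer-24720` (helper, Theses-free).
THEOREMS ONLY (no `def`, no named fact, no `sorry`); nothing is closed; BSD is not proved by any of this.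

`FrameSeed.exists_seed_core` (cruxlead-23721 g3) CONSTRUCTS, for every quadratic `θK` on the split dyadic frame, a seed
`η` of type `(−a, 0)` (`a ∈ {1, 2}`), unramified off `v`, with a `2`-adic avatar through the pair and `θK⁻¹η` unramified
at `v` — but its STATEMENT packages the type as `∃ b ≤ a, (−a, b)`, which is what the full-range rigidity wanted. The
`j = 0` torsion supply (socket `KatzPeriodRigidity.span_eq_span_of_isKatzMeasure₂₀_of_torsionSupply`) needs `b = 0`
on the nose. This file re-runs the SAME construction with the sharpened conclusion:

* `seed_of_matched₀` — the finish with `(fun _ ↦ 0)` as second infinity type and `η` unramified off `v` kept;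
* ★ `exists_seed_core₀` — the core seed with type `(−a, 0)` exposed.

The proof is `exists_seed_core` VERBATIM (adapted from `…FrameSeed.lean` §4; the three private sign tables are
re-declared), ending in `seed_of_matched₀`. beyond-print theorem: no.

References: [deShalit1987] II.4.17 (52)–(54); [SerreAbelianLadic1968] Ch. II §2.7; [IrelandRosen1982] Ch. 18 §7;
[Omeara1963] §63A.
-/

-- the summit namespace `Summit.BirchSwinnertonDyer.BirchSwinnertonDyer` repeats the problem name by design (D-0017)
set_option linter.dupNamespace false
set_option autoImplicit false

noncomputable section

open scoped Classical

open NumberField IsDedekindDomain Field WeierstrassCurve Literature.NumberTheory.GaloisRepresentations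
  Literature.NumberTheory.EllipticCurves Literature.NumberTheory.EllipticCurves.Rank1Residual

namespace Summit.BirchSwinnertonDyer.BirchSwinnertonDyer.Theorems.PrintCf2.FrameSeed

variable {K : Type} [Field K] [NumberField K]

/-! ## §1 The sign tables (private, as in the parent file) -/

/-- `χ₈, χ₈'` at `±1, ±5 ∈ ℤ/8`. [folklore] -/
private theorem chi_table₀ :
    ZMod.χ₈ (1 : ZMod (2 ^ 3)) = 1 ∧ ZMod.χ₈ (-1 : ZMod (2 ^ 3)) = 1 ∧
    ZMod.χ₈ (5 : ZMod (2 ^ 3)) = -1 ∧ ZMod.χ₈ (-5 : ZMod (2 ^ 3)) = -1 ∧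
    ZMod.χ₈' (1 : ZMod (2 ^ 3)) = 1 ∧ ZMod.χ₈' (-1 : ZMod (2 ^ 3)) = -1 ∧
    ZMod.χ₈' (5 : ZMod (2 ^ 3)) = -1 ∧ ZMod.χ₈' (-5 : ZMod (2 ^ 3)) = 1 := by
  decide

/-- The odd characters `χ₄ = χ₈χ₈'` and `χ₈'` of `(ℤ/8)ˣ` take the value `−1` at `−1`. [folklore] -/
private theorem chi_odd₀ : (ZMod.χ₈ * ZMod.χ₈') (-1 : ZMod 8) = -1 ∧ ZMod.χ₈' (-1 : ZMod 8) = -1 := by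
  decide

/-- `(χ₈χ₈')(x) = χ₈(x)χ₈'(x)`. [folklore] -/
private theorem chi4_apply₀ (x : ZMod 8) : (ZMod.χ₈ * ZMod.χ₈') x = ZMod.χ₈ x * ZMod.χ₈' x := rfl


/-! ## §2 The finish at `j = 0` -/

section Finish


variable {v vbar : HeightOneSpectrum (𝓞 K)} (hv2 : ((2 : ℕ) : 𝓞 K) ∈ v.asIdeal)
  {ι : PadicAlgCl 2 ≃+* ℂ} {κ₁ κ₂ : ZpExtension K 2} {θK : HeckeCharacter K} (hθ : θK * θK = 1)
  {Sθ : Finset (HeightOneSpectrum (𝓞 K))}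
  (hSunr : ∀ w : HeightOneSpectrum (𝓞 K), w ∉ Sθ → w ≠ v → w ≠ vbar → θK.IsUnramifiedAt w)
include hv2 hθ hSunr

/-- **From a matched seed to B18s' conclusion**: a Hecke character `η` of type `(−a, 0)`, unramified off `v`,
with a `2`-adic avatar through the pair and `θK⁻¹η` unramified at `v`, is a seed.
[cite: deShalit1987, II.4.17 (54)] -/
theorem seed_of_matched₀ {η : HeckeCharacter K} {e : FramedGaloisRep K (PadicAlgCl 2) 1} {a : ℕ}
    (he : IsPAdicAvatarOf ι η e) (hfe : FactorsThroughPair κ₁ κ₂ e)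
    (hηu : ∀ w : HeightOneSpectrum (𝓞 K), w ≠ v → η.IsUnramifiedAt w)
    (hηt : η.HasInfinityType (fun _ ↦ -(a : ℤ)) (fun _ ↦ 0))
    (hmatch : (θK⁻¹ * η).IsUnramifiedAt v) :
    ∃ (η : HeckeCharacter K) (e : FramedGaloisRep K (PadicAlgCl 2) 1) (a : ℕ),
      IsPAdicAvatarOf ι η e ∧ FactorsThroughPair κ₁ κ₂ e ∧
      (∀ w : HeightOneSpectrum (𝓞 K), ((2 : ℕ) : 𝓞 K) ∉ w.asIdeal → η.IsUnramifiedAt w) ∧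
      (∀ w : HeightOneSpectrum (𝓞 K), w ≠ v → η.IsUnramifiedAt w) ∧
      (θK⁻¹ * η).HasInfinityType (fun _ ↦ -(a : ℤ)) (fun _ ↦ 0) ∧
      ∀ w : HeightOneSpectrum (𝓞 K), w ∉ Sθ → w ≠ vbar → (θK⁻¹ * η).IsUnramifiedAt w := by
  refine ⟨η, e, a, he, hfe, fun w hw ↦ hηu w (by rintro rfl; exact hw hv2), hηu, ?_, ?_⟩
  · have hθt : θK⁻¹.HasInfinityType (fun _ ↦ 0) (fun _ ↦ 0) := by
      rw [inv_eq_self_of_mul_self hθ]; exact hasInfinityType_zero_of_mul_self hθ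
    have h := hθt.mul' hηt
    have e1 : ((fun _ ↦ 0) + (fun _ ↦ -(a : ℤ)) : InfinitePlace K → ℤ) = fun _ ↦ -(a : ℤ) := by
      funext w; simp
    have e2 : ((fun _ ↦ 0) + (fun _ ↦ 0) : InfinitePlace K → ℤ) = fun _ ↦ (0 : ℤ) := by
      funext w; simp
    rw [e1, e2] at h
    exact h
  · intro w hwS hwvbar
    by_cases hwv : w = v
    · subst hwv; exact hmatch
    · exact (hSunr w hwS hwv hwvbar).inv'.mul' (hηu w hwv)


end Finish

/-! ## §3 The core seed with type `(−a, 0)` -/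

section Core

/-- **THE SEED SUPPLY (core form), WITH THE INFINITY TYPE `(−a, 0)` ON THE NOSE** (the `j = 0` twin of
`exists_seed_core`: same construction, conclusion sharpened to `b = 0` and `η` unramified off `v`).  `K` imaginary quadratic with `√−7 ∈ K`; `v` a place with
`2 ∈ 𝔭_v`, `ord_v 2 = 1`; `ι : ℚ̄₂ ≃+* ℂ` pinned to `v`; `(κ₁, κ₂; γ₁, γ₂)` a generator pair of the
`ℤ₂²`-tower; `θK` a Hecke character with `θK² = 1`, unramified off `Sθ ∪ {v, v̄}`.  Then there are `η`, a
`2`-adic avatar `e` of `η` through the pair, and `b ≤ a` with `η` unramified away from `2`, `θK⁻¹η` of type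
`(−a, b)` and unramified at every `w ∉ Sθ ∪ {v̄}`. [cite: deShalit1987, II.4.17 (52)–(54)]
[cite: SerreAbelianLadic1968, Ch. II §2.7] [cite: IrelandRosen1982, Ch. 18 §7] -/
theorem exists_seed_core₀ (hK : IsImaginaryQuadratic K) {θ : K} (hθ7 : θ ^ 2 = -7)
    {v vbar : HeightOneSpectrum (𝓞 K)} (hv2 : ((2 : ℕ) : 𝓞 K) ∈ v.asIdeal)
    (h2v : v.intValuation (2 : 𝓞 K) = WithZero.exp (-1 : ℤ))
    (ι : PadicAlgCl 2 ≃+* ℂ)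
    (hι : ∀ (w : InfinitePlace K) (k : 𝓞 K), k ∈ v.asIdeal ↔ ‖ι.symm (w.embedding (k : K))‖ < 1)
    {κ₁ κ₂ : ZpExtension K 2} {γ₁ γ₂ : absoluteGaloisGroup K} (hpair : ZpExtension.IsTopGeneratorPair κ₁ κ₂ γ₁ γ₂)
    {θK : HeckeCharacter K} (hθ : θK * θK = 1) {Sθ : Finset (HeightOneSpectrum (𝓞 K))}
    (hSunr : ∀ w : HeightOneSpectrum (𝓞 K), w ∉ Sθ → w ≠ v → w ≠ vbar → θK.IsUnramifiedAt w) :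
    ∃ (η : HeckeCharacter K) (e : FramedGaloisRep K (PadicAlgCl 2) 1) (a : ℕ),
      IsPAdicAvatarOf ι η e ∧ FactorsThroughPair κ₁ κ₂ e ∧
      (∀ w : HeightOneSpectrum (𝓞 K), ((2 : ℕ) : 𝓞 K) ∉ w.asIdeal → η.IsUnramifiedAt w) ∧
      (∀ w : HeightOneSpectrum (𝓞 K), w ≠ v → η.IsUnramifiedAt w) ∧
      (θK⁻¹ * η).HasInfinityType (fun _ ↦ -(a : ℤ)) (fun _ ↦ 0) ∧
      ∀ w : HeightOneSpectrum (𝓞 K), w ∉ Sθ → w ≠ vbar → (θK⁻¹ * η).IsUnramifiedAt w := by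
  -- the infinite place and the embedding `𝓞 K → ℤ₂`
  obtain ⟨w₀⟩ : Nonempty (InfinitePlace K) := inferInstance
  haveI : Subsingleton (InfinitePlace K) :=
    Fintype.card_le_one_iff_subsingleton.mp hK.card_infinitePlace_eq_one.le
  have he : ∀ w : InfinitePlace K, w.embedding = w₀.embedding := fun w ↦ by rw [Subsingleton.elim w w₀]
  set φK : K →+* PadicAlgCl 2 := (ι.symm : ℂ ≃+* PadicAlgCl 2).toRingHom.comp w₀.embedding with hφK
  have hφKv : ∀ k : 𝓞 K, k ∈ v.asIdeal ↔ ‖φK (k : K)‖ < 1 := fun k ↦ hι w₀ k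
  obtain ⟨φ₀, hφ₀⟩ := exists_intEmb hK.1 hθ7 φK
  have hφe : ∀ k : 𝓞 K, algebraMap ℚ_[2] (PadicAlgCl 2) ((φ₀ k : ℤ_[2]) : ℚ_[2]) = ι.symm (w₀.embedding (k : K)) :=
    hφ₀
  have hvd : ∀ k : 𝓞 K, k ∈ v.asIdeal ↔ (2 : ℤ_[2]) ∣ φ₀ k := mem_iff_two_dvd_of_norm hφ₀ hφKv
  -- the two seed Größencharaktere and their inverse avatars
  obtain ⟨ωA, ωB, ⟨hAi, hBi⟩, hU, hF, hL, hC⟩ :=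
    exists_seedChar_pair hK hθ7 he hvd (ZMod.χ₈ * ZMod.χ₈') ZMod.χ₈' chi_odd₀.1 chi_odd₀.2
  have hF' : ∀ w : HeightOneSpectrum (𝓞 K), ∃ g : 𝓞 K, w ≠ v → (g ∉ v.asIdeal ∧
      ωA.valueAtUniformizer w =
        w₀.embedding (g : K) * (((ZMod.χ₈ * ZMod.χ₈') (PadicInt.toZModPow 3 (φ₀ g)) : ℤ) : ℂ)⁻¹ ∧
      ωB.valueAtUniformizer w =
        w₀.embedding (g : K) * ((ZMod.χ₈' (PadicInt.toZModPow 3 (φ₀ g)) : ℤ) : ℂ)⁻¹) := by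
    intro w
    by_cases h : w ≠ v
    · obtain ⟨g, hg⟩ := hF w h
      exact ⟨g, fun _ ↦ hg⟩
    · exact ⟨0, fun h' ↦ absurd h' h⟩
  choose g hgall using hF'
  have hg : ∀ w : HeightOneSpectrum (𝓞 K), w ≠ v → g w ∉ v.asIdeal := fun w h ↦ (hgall w h).1
  have hgA : ∀ w : HeightOneSpectrum (𝓞 K), w ≠ v → ωA.valueAtUniformizer w =
      w₀.embedding (g w : K) * (((ZMod.χ₈ * ZMod.χ₈') (PadicInt.toZModPow 3 (φ₀ (g w))) : ℤ) : ℂ)⁻¹ :=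
    fun w h ↦ (hgall w h).2.1
  have hgB : ∀ w : HeightOneSpectrum (𝓞 K), w ≠ v → ωB.valueAtUniformizer w =
      w₀.embedding (g w : K) * ((ZMod.χ₈' (PadicInt.toZModPow 3 (φ₀ (g w))) : ℤ) : ℂ)⁻¹ :=
    fun w h ↦ (hgall w h).2.2
  obtain ⟨rA, χzA, hrA, heA, hfrA⟩ :=
    exists_unitsChar_avatar_inv ι hφe hvd ⟨_, _, hAi⟩ (fun w h ↦ (hU w h).1) hg hgA
  obtain ⟨rB, χzB, hrB, heB, hfrB⟩ :=
    exists_unitsChar_avatar_inv ι hφe hvd ⟨_, _, hBi⟩ (fun w h ↦ (hU w h).2) hg hgB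
  have hfrA' : ∀ w : HeightOneSpectrum (𝓞 K), w ≠ v → ((2 : ℕ) : 𝓞 K) ∉ w.asIdeal →
      ∀ 𝔓 ∈ w.primesAbove, ∀ Φ : absoluteGaloisGroup K, IsArithFrobAt (𝓞 K) Φ 𝔓 →
        ((χzA Φ : ℤ_[2]ˣ) : ℤ_[2]) = φ₀ (g w) *
          ((ZMod.χ₈ (PadicInt.toZModPow 3 (φ₀ (g w))) * ZMod.χ₈' (PadicInt.toZModPow 3 (φ₀ (g w))) : ℤ) : ℤ_[2]) :=
    fun w h h2 𝔓 h𝔓 Φ hΦ ↦ by rw [hfrA w h h2 𝔓 h𝔓 Φ hΦ, chi4_apply₀]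
  have hfA : FactorsThroughPair κ₁ κ₂ rA := factorsThroughPair_of_principal hvd hK hpair heA hg hfrA'
  have hfB : FactorsThroughPair κ₁ κ₂ rB := factorsThroughPair_of_rel hvd heA heB hg hfrA' hfrB hfA
  -- inverse seeds: unramified off `v`, type `(-1, 0)`
  have hAu : ∀ w : HeightOneSpectrum (𝓞 K), w ≠ v → ωA⁻¹.IsUnramifiedAt w := fun w h ↦ (hU w h).1.inv'
  have hBu : ∀ w : HeightOneSpectrum (𝓞 K), w ≠ v → ωB⁻¹.IsUnramifiedAt w := fun w h ↦ (hU w h).2.inv'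
  have hAu2 : ∀ w : HeightOneSpectrum (𝓞 K), ((2 : ℕ) : 𝓞 K) ∉ w.asIdeal → ωA⁻¹.IsUnramifiedAt w :=
    fun w hw ↦ hAu w (by rintro rfl; exact hw hv2)
  have hAt : ωA⁻¹.HasInfinityType (fun _ ↦ -((1 : ℕ) : ℤ)) (fun _ ↦ 0) := by
    have h := hAi.inv
    have e1 : (-(fun _ ↦ 1 : InfinitePlace K → ℤ)) = fun _ ↦ -((1 : ℕ) : ℤ) := by funext w; simp
    have e2 : (-(fun _ ↦ 0 : InfinitePlace K → ℤ)) = fun _ ↦ 0 := by funext w; simp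
    rw [e1, e2] at h; exact h
  have hBt : ωB⁻¹.HasInfinityType (fun _ ↦ -((1 : ℕ) : ℤ)) (fun _ ↦ 0) := by
    have h := hBi.inv
    have e1 : (-(fun _ ↦ 1 : InfinitePlace K → ℤ)) = fun _ ↦ -((1 : ℕ) : ℤ) := by funext w; simp
    have e2 : (-(fun _ ↦ 0 : InfinitePlace K → ℤ)) = fun _ ↦ 0 := by funext w; simp
    rw [e1, e2] at h; exact h
  have htwo : ∀ {η₁ η₂ : HeckeCharacter K}, η₁.HasInfinityType (fun _ ↦ -((1 : ℕ) : ℤ)) (fun _ ↦ 0) →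
      η₂.HasInfinityType (fun _ ↦ -((1 : ℕ) : ℤ)) (fun _ ↦ 0) →
      (η₁ * η₂).HasInfinityType (fun _ ↦ -((2 : ℕ) : ℤ)) (fun _ ↦ 0) := by
    intro η₁ η₂ h₁ h₂
    have h := h₁.mul' h₂
    have e1 : ((fun _ ↦ -((1 : ℕ) : ℤ)) + (fun _ ↦ -((1 : ℕ) : ℤ)) : InfinitePlace K → ℤ) =
        fun _ ↦ -((2 : ℕ) : ℤ) := by funext w; norm_num
    have e2 : ((fun _ ↦ 0) + (fun _ ↦ 0) : InfinitePlace K → ℤ) = fun _ ↦ 0 := by funext w; simp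
    rw [e1, e2] at h; exact h
  -- congruence subgroup and local values of the inverse seeds
  have hAc : ∀ q : (v.adicCompletion K)ˣ, Valued.v ((q : v.adicCompletion K) - 1) ≤ WithZero.exp (-(3 : ℤ)) →
      ωA⁻¹ (localUnits v q) = 1 := fun q hq ↦ by rw [HeckeCharacter.inv_apply, (hC q hq).1, inv_one]
  have hBc : ∀ q : (v.adicCompletion K)ˣ, Valued.v ((q : v.adicCompletion K) - 1) ≤ WithZero.exp (-(3 : ℤ)) →
      ωB⁻¹ (localUnits v q) = 1 := fun q hq ↦ by rw [HeckeCharacter.inv_apply, (hC q hq).2, inv_one]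
  have hAl : ∀ a : 𝓞 K, a ∉ v.asIdeal → ∀ ha : algebraMap K (v.adicCompletion K) (a : K) ≠ 0,
      ((ωA⁻¹ (localUnits v (Units.mk0 _ ha)) : ℂˣ) : ℂ) =
        ((((ZMod.χ₈ * ZMod.χ₈') (PadicInt.toZModPow 3 (φ₀ a))) : ℤ) : ℂ)⁻¹ := fun a ha haK ↦ by
    rw [HeckeCharacter.inv_apply, Units.val_inv_eq_inv_val, (hL a ha haK).1]
  have hBl : ∀ a : 𝓞 K, a ∉ v.asIdeal → ∀ ha : algebraMap K (v.adicCompletion K) (a : K) ≠ 0,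
      ((ωB⁻¹ (localUnits v (Units.mk0 _ ha)) : ℂˣ) : ℂ) =
        (((ZMod.χ₈' (PadicInt.toZModPow 3 (φ₀ a))) : ℤ) : ℂ)⁻¹ := fun a ha haK ↦ by
    rw [HeckeCharacter.inv_apply, Units.val_inv_eq_inv_val, (hL a ha haK).2]
  -- the two signs of `θK` at `v`
  have hne : ∀ b : 𝓞 K, b ∉ v.asIdeal → algebraMap K (v.adicCompletion K) (b : K) ≠ 0 := fun b hb h0 ↦ by
    have h1 : Valued.v (algebraMap K (v.adicCompletion K) (b : K)) = 1 := by
      rw [Literature.NumberTheory.GaloisRepresentations.valued_algebraMap_adicCompletion,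
        RingOfIntegers.coe_eq_algebraMap, HeightOneSpectrum.valuation_of_algebraMap,
        HeightOneSpectrum.intValuation_eq_one_iff.mpr hb]
    rw [h0, map_zero] at h1; exact zero_ne_one h1
  have hn1 : (-1 : 𝓞 K) ∉ v.asIdeal := rep_not_mem h2v (Or.inr (Or.inl rfl))
  have h5 : (5 : 𝓞 K) ∉ v.asIdeal := rep_not_mem h2v (Or.inr (Or.inr (Or.inl rfl)))
  set s₁ : ℂ := ((θK (localUnits v (Units.mk0 _ (hne _ hn1))) : ℂˣ) : ℂ) with hs₁def
  set s₅ : ℂ := ((θK (localUnits v (Units.mk0 _ (hne _ h5))) : ℂˣ) : ℂ) with hs₅def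
  have hs₁ : ∀ ha : algebraMap K (v.adicCompletion K) ((-1 : 𝓞 K) : K) ≠ 0,
      ((θK (localUnits v (Units.mk0 _ ha)) : ℂˣ) : ℂ) = s₁ := fun _ ↦ rfl
  have hs₅ : ∀ ha : algebraMap K (v.adicCompletion K) ((5 : 𝓞 K) : K) ≠ 0,
      ((θK (localUnits v (Units.mk0 _ ha)) : ℂˣ) : ℂ) = s₅ := fun _ ↦ rfl
  obtain ⟨t1, tn1, t5, tn5, t1', tn1', t5', tn5'⟩ := chi_table₀
  -- four cases
  rcases coe_apply_eq_one_or_of_mul_self hθ (localUnits v (Units.mk0 _ (hne _ hn1))) with e₁ | e₁ <;>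
    rcases coe_apply_eq_one_or_of_mul_self hθ (localUnits v (Units.mk0 _ (hne _ h5))) with e₅ | e₅ <;>
    rw [← hs₁def] at e₁ <;> rw [← hs₅def] at e₅
  · -- `θK|𝒪_vˣ = 1`: seed `ω_A⁻²`
    refine seed_of_matched₀ hv2 hθ hSunr (hrA.mul_twist hrA hAu2) (factorsThroughPair_twist_detChar hfA hfA)
      (fun w h ↦ (hAu w h).mul' (hAu w h)) (htwo hAt hAt) ?_
    refine isUnramifiedAt_inv_mul_of_signs hvd h2v hθ
      (fun t ↦ ((((ZMod.χ₈ * ZMod.χ₈') t) : ℤ) : ℂ)⁻¹ * ((((ZMod.χ₈ * ZMod.χ₈') t) : ℤ) : ℂ)⁻¹)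
      (fun q hq ↦ by rw [HeckeCharacter.mul_apply, hAc q hq, one_mul])
      (fun a ha haK ↦ by rw [HeckeCharacter.mul_apply, Units.val_mul, hAl a ha haK]) hs₁ hs₅ ?_ ?_ ?_ ?_
    all_goals simp only [chi4_apply₀, t1, tn1, t5, tn5, t1', tn1', t5', tn5', e₁, e₅]; norm_num
  · -- `θK(⟨−1⟩) = 1, θK(⟨5⟩) = −1` (`χ₈`): seed `ω_A⁻¹ω_B⁻¹`
    refine seed_of_matched₀ hv2 hθ hSunr (hrB.mul_twist hrA hAu2) (factorsThroughPair_twist_detChar hfB hfA)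
      (fun w h ↦ (hAu w h).mul' (hBu w h)) (htwo hAt hBt) ?_
    refine isUnramifiedAt_inv_mul_of_signs hvd h2v hθ
      (fun t ↦ ((((ZMod.χ₈ * ZMod.χ₈') t) : ℤ) : ℂ)⁻¹ * (((ZMod.χ₈' t) : ℤ) : ℂ)⁻¹)
      (fun q hq ↦ by rw [HeckeCharacter.mul_apply, hAc q hq, hBc q hq, one_mul])
      (fun a ha haK ↦ by rw [HeckeCharacter.mul_apply, Units.val_mul, hAl a ha haK, hBl a ha haK]) hs₁ hs₅ ?_ ?_ ?_ ?_
    all_goals simp only [chi4_apply₀, t1, tn1, t5, tn5, t1', tn1', t5', tn5', e₁, e₅]; norm_num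
  · -- `θK(⟨−1⟩) = −1, θK(⟨5⟩) = 1` (`χ₄`): seed `ω_A⁻¹`
    refine seed_of_matched₀ hv2 hθ hSunr hrA hfA hAu hAt ?_
    refine isUnramifiedAt_inv_mul_of_signs hvd h2v hθ
      (fun t ↦ ((((ZMod.χ₈ * ZMod.χ₈') t) : ℤ) : ℂ)⁻¹) hAc hAl hs₁ hs₅ ?_ ?_ ?_ ?_
    all_goals simp only [chi4_apply₀, t1, tn1, t5, tn5, t1', tn1', t5', tn5', e₁, e₅]; norm_num
  · -- `θK(⟨−1⟩) = −1, θK(⟨5⟩) = −1` (`χ₈'`): seed `ω_B⁻¹`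
    refine seed_of_matched₀ hv2 hθ hSunr hrB hfB hBu hBt ?_
    refine isUnramifiedAt_inv_mul_of_signs hvd h2v hθ
      (fun t ↦ (((ZMod.χ₈' t) : ℤ) : ℂ)⁻¹) hBc hBl hs₁ hs₅ ?_ ?_ ?_ ?_
    all_goals simp only [t1', tn1', t5', tn5', e₁, e₅]; norm_num

end Core

end Summit.BirchSwinnertonDyer.BirchSwinnertonDyer.Theorems.PrintCf2.FrameSeed

end
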